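import Summits.ResolutionOfSingularities.ResolutionOfSingularities.Theorems.RadicialJungCleanModelsNSAbsorption
import HarnessLib

/-!
# The absorption step with the residue-units of the coefficients taken in the LOCAL RING (variant needed by step (S6) of the assembly)

Route `RadicialJung`, crux `CleanModels` (stmt-ResolutionOfSingularities-15917), registered skeleton `Cruxes/CleanModels/Lines/Sketch.lean`
rev 35 (sha16 de44649d8f729c3b), stub 7 `stub_cleanModelsDimGEFour`.  Explicit-unit seat `decomp-res-hand-2` g5 (structural hand); memo
`Cruxes/CleanModels/Lines/Sketch-memo-hand2-g5-stubs-5-7.md` §3 (S6 caveat).  OURS; structural bookkeeping, counted 0; nothing here proves resolution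
of singularities in characteristic `p`.

✓ `absorption_step` asks the congruence `c_z ≡ u_z · x^{δ_z} (mod 𝔭 A_𝔮)` with `u_z` IN THE MODEL `A`.  The residue-side data of the assembly
(`c̄_z = ū · x̄^δ` in the residue ring `ρ(locAtCentre A O)`) only provide `u_z ∈ locAtCentre A O` (a fraction `p/(q ∏ e_i^{δ_i})` of model
elements with `ν`-unit denominator).  This file re-runs the proof of ✓ `absorption_step` VERBATIM with that weaker hypothesis — `u : K → K`,
`u z ∈ locAtCentre A O`, `ν(u z) = 0`, and the congruence witnessed by `π_z := s · (c_z − u_z x^{δ_z}) ∈ locAtCentre A O` of positive `ν₁`-value —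
the only change being that `π_z = n/e` is first written as a fraction of a model element `n ∈ 𝔭` by a `ν`-unit `e`.

* `absorption_step_loc`.
[cite: NovacoskiSpivakovsky2014, §3.2 (21)–(24) and Lemma 2.19]
-/

noncomputable section

set_option linter.dupNamespace false -- mandated namespace of this single-conjunct summit

open IsLocalRing
open Literature.AlgebraicGeometry.Resolution

namespace Summit.ResolutionOfSingularities.ResolutionOfSingularities.Theorems.RadicialJung.CleanModels

variable {k K : Type} [Field k] [Field K] [Algebra k K]

/-- **The absorption step, local-unit form** (see the module docstring; = ✓ `absorption_step` with `u_z ∈ locAtCentre A O`): in the setting of the module docstring, ONE blowing up along `(∏ x_l^{m_l}, Y)` produces an affine model `A ⊆ A' ⊆ O`, finitely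
generated, with the SAME local ring at the centre of `ν₁`, regular at the centre of `ν`, with an explicit generating family of its maximal ideal
of size its dimension in which every non-zero `z ∈ Z` is a unit times a monomial. [cite: NovacoskiSpivakovsky2014, §3.2 (21)–(24) and Lemma 2.19] -/
theorem absorption_step_loc (O O₁ : ValuationSubring K) (hO : O ≤ O₁)
    (A : Subalgebra k K) (hA : A.toSubring ≤ O.toSubring) (hAfg : A.FG) (hfrac : IsFractionRing A K)
    (Y : Finset A.toSubring)
    (hIY : ((maximalIdeal O₁).comap (Subring.inclusion (hA.trans hO))) = Ideal.span (Y : Set A.toSubring))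
    (hYcard : (Y.card : WithBot ℕ∞) ≤ ringKrullDim
      (Localization.AtPrime ((maximalIdeal O₁).comap (Subring.inclusion (hA.trans hO)))))
    (hregQ : IsRegularLocalRing
      (Localization.AtPrime ((maximalIdeal O).comap (Subring.inclusion hA)) ⧸
        ((maximalIdeal O₁).comap (Subring.inclusion (hA.trans hO))).map
          (algebraMap A.toSubring
            (Localization.AtPrime ((maximalIdeal O).comap (Subring.inclusion hA))))))
    (t : ℕ) (x : Fin t → A.toSubring)
    (hdimt : ringKrullDim
      (Localization.AtPrime ((maximalIdeal O).comap (Subring.inclusion hA)) ⧸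
        ((maximalIdeal O₁).comap (Subring.inclusion (hA.trans hO))).map
          (algebraMap A.toSubring
            (Localization.AtPrime ((maximalIdeal O).comap (Subring.inclusion hA))))) = t)
    (hxQ : ∀ l, O.valuation ((x l : A.toSubring) : K) < 1) (hxP : ∀ l, O₁.valuation ((x l : A.toSubring) : K) = 1)
    (hx𝔪 : ∀ c : A.toSubring, O.valuation (c : K) < 1 →
      ∃ (s : A.toSubring) (b : Fin t → A.toSubring), O.valuation (s : K) = 1 ∧
        O₁.valuation (((s * c - ∑ l, b l * x l : A.toSubring)) : K) < 1)
    (Z : Finset K) (c : K → A.toSubring) (γ : K → A.toSubring → ℕ) (u : K → K) (δ : K → Fin t → ℕ)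
    (m : Fin t → ℕ)
    (hz : ∀ z ∈ Z, z = ((c z : A.toSubring) : K) * ∏ y ∈ Y, ((y : A.toSubring) : K) ^ (γ z y))
    (hu : ∀ z ∈ Z, u z ∈ locAtCentre A.toSubring O ∧ O.valuation (u z) = 1)
    (hcu : ∀ z ∈ Z, ∃ s : A.toSubring, O.valuation (s : K) = 1 ∧
      O₁.valuation ((s : K) * (((c z : A.toSubring) : K) - u z * ∏ l, ((x l : A.toSubring) : K) ^ (δ z l))) < 1)
    (hδm : ∀ z ∈ Z, ∀ l, δ z l ≤ m l) :
    ∃ (A' : Subalgebra k K), A'.toSubring ≤ O.toSubring ∧ A ≤ A' ∧ A'.FG ∧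
      locAtCentre A'.toSubring O₁ = locAtCentre A.toSubring O₁ ∧
    ∃ (_ : IsRegularLocalRing (locAtCentre A'.toSubring O)) (e : ℕ) (a : Fin e → ↥(locAtCentre A'.toSubring O)),
      Ideal.span (Set.range a) = IsLocalRing.maximalIdeal ↥(locAtCentre A'.toSubring O) ∧
      ringKrullDim ↥(locAtCentre A'.toSubring O) = (e : WithBot ℕ∞) ∧
      ∀ z ∈ Z, z ≠ 0 → ∃ (v : ↥(locAtCentre A'.toSubring O)) (μ : Fin e → ℕ), IsUnit v ∧
        z = (v : K) * ∏ i, ((a i : ↥(locAtCentre A'.toSubring O)) : K) ^ (μ i) := by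
  classical
  haveI : IsFractionRing A.toSubring K := hfrac
  have hAO₁ : A.toSubring ≤ O₁.toSubring := hA.trans hO
  set P := ((maximalIdeal O₁).comap (Subring.inclusion hAO₁)) with hPdef
  set Q := ((maximalIdeal O).comap (Subring.inclusion hA)) with hQdef
  have hmemP : ∀ g : A.toSubring, g ∈ P ↔ O₁.valuation (g : K) < 1 := fun g => by
    rw [hPdef, Ideal.mem_comap, ValuationSubring.valuation_lt_one_iff]; rfl
  have hmemQ : ∀ g : A.toSubring, g ∈ Q ↔ O.valuation (g : K) < 1 := fun g => by
    rw [hQdef, Ideal.mem_comap, ValuationSubring.valuation_lt_one_iff]; rfl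
  -- `a₀ := ∏ x_l ^ m_l ∉ 𝔭`
  set a₀ : A.toSubring := ∏ l, x l ^ m l with ha₀def
  have ha₀1 : O₁.valuation (a₀ : K) = 1 := by
    rw [ha₀def]; push_cast
    rw [map_prod]
    exact Finset.prod_eq_one fun l _ => by rw [map_pow, hxP l, one_pow]
  have ha₀P : a₀ ∈ P.primeCompl := (mem_primeCompl_centre_iff O₁ A hAO₁ a₀).mpr ha₀1
  have ha₀0 : (a₀ : K) ≠ 0 := ne_zero_of_valuation_eq_one ha₀1
  -- THE BLOWING UP along `(a₀, Y)`
  obtain ⟨A', hA'O, hAA', hA'fg, -, hregQ', hα, ⟨Y', hY', hY'card, hY'val, hY'Y, hYY'⟩, hres⟩ :=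
    blowupAlong_generators_of_centre O O₁ hO A hA hAfg hfrac hregQ Y hIY hYcard a₀ ha₀P
  have hA'O₁ : A'.toSubring ≤ O₁.toSubring := hA'O.trans hO
  have hAA'' : A.toSubring ≤ A'.toSubring := fun g hg => hAA' hg
  set P' := ((maximalIdeal O₁).comap (Subring.inclusion hA'O₁)) with hP'def
  set Q' := ((maximalIdeal O).comap (Subring.inclusion hA'O)) with hQ'def
  have hP'Q' : P' ≤ Q' := centre_mono O O₁ hO A' hA'O
  have hmemP' : ∀ g : A'.toSubring, g ∈ P' ↔ O₁.valuation (g : K) < 1 := fun g => by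
    rw [hP'def, Ideal.mem_comap, ValuationSubring.valuation_lt_one_iff]; rfl
  have hmemQ' : ∀ g : A'.toSubring, g ∈ Q' ↔ O.valuation (g : K) < 1 := fun g => by
    rw [hQ'def, Ideal.mem_comap, ValuationSubring.valuation_lt_one_iff]; rfl
  haveI hfrac' : IsFractionRing A'.toSubring K := isFractionRing_subalgebra_of_le A A' hAA'
  haveI hnoeth' : IsNoetherianRing A'.toSubring := isNoetherianRing_of_fg hA'fg
  -- valuation bookkeeping
  have hvalA'le : ∀ g : K, g ∈ A' → O.valuation g ≤ 1 := fun g hg =>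
    (O.valuation_le_one_iff _).mpr (hA'O hg)
  have hvalQ'ofP' : ∀ g : K, g ∈ A' → O₁.valuation g < 1 → O.valuation g < 1 := by
    intro g hg hg1
    have : (⟨g, hg⟩ : A'.toSubring) ∈ Q' := hP'Q' ((hmemP' ⟨g, hg⟩).mpr hg1)
    exact (hmemQ' _).mp this
  -- `Y / a₀ ⊆ A'`, with values `< 1`
  have hYP : ∀ y ∈ Y, O₁.valuation ((y : A.toSubring) : K) < 1 := fun y hy =>
    (hmemP y).mp (hIY ▸ Ideal.subset_span hy)
  have hydivA' : ∀ y ∈ Y, ((y : A.toSubring) : K) / (a₀ : K) ∈ A' := by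
    intro y hy
    obtain ⟨y', -, hy'⟩ := hYY' y hy
    rw [← hy']; exact y'.2
  have hydiv1 : ∀ y ∈ Y, O₁.valuation (((y : A.toSubring) : K) / (a₀ : K)) < 1 := by
    intro y hy
    rw [map_div₀, ha₀1, div_one]; exact hYP y hy
  have hydivQ : ∀ y ∈ Y, O.valuation (((y : A.toSubring) : K) / (a₀ : K)) < 1 := fun y hy =>
    hvalQ'ofP' _ (hydivA' y hy) (hydiv1 y hy)
  -- `𝔭 ⊆ a₀ · A'`: every `π ∈ 𝔭` has `π / a₀ ∈ A'`, of `ν₁`-value `< 1`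
  have hPdiv : ∀ π : A.toSubring, π ∈ P → (π : K) / (a₀ : K) ∈ A' ∧ O₁.valuation ((π : K) / (a₀ : K)) < 1 := by
    intro π hπ
    refine ⟨?_, by rw [map_div₀, ha₀1, div_one]; exact (hmemP π).mp hπ⟩
    rw [hIY] at hπ
    refine Submodule.span_induction (p := fun g _ => ((g : A.toSubring) : K) / (a₀ : K) ∈ A') ?_ ?_ ?_ ?_ hπ
    · intro g hg; exact hydivA' g hg
    · simp only [ZeroMemClass.coe_zero, zero_div]; exact A'.zero_mem
    · intro g g' _ _ hg hg'
      simp only [AddMemClass.coe_add, add_div]; exact A'.add_mem hg hg'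
    · intro r g _ hg
      simp only [smul_eq_mul, Subring.coe_mul, mul_div_assoc]
      exact A'.mul_mem (hAA' r.2) hg
  -- THE LOCAL RING `L` at the centre of `ν` on `A'`
  haveI hLloc : IsLocalRing (locAtCentre A'.toSubring O) := isLocalRing_locAtCentre hA'O
  let ιA' : A'.toSubring →+* locAtCentre A'.toSubring O := Subring.inclusion (le_locAtCentre A'.toSubring O)
  let ιA : A.toSubring →+* locAtCentre A'.toSubring O := ιA'.comp (Subring.inclusion hAA'')
  have hιA'val : ∀ g : A'.toSubring, ((ιA' g : locAtCentre A'.toSubring O) : K) = (g : K) := fun _ => rfl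
  have hιAval : ∀ g : A.toSubring, ((ιA g : locAtCentre A'.toSubring O) : K) = (g : K) := fun _ => rfl
  have hmem𝔪 : ∀ g : locAtCentre A'.toSubring O, g ∈ maximalIdeal _ ↔ O.valuation (g : K) < 1 :=
    fun g => mem_maximalIdeal_locAtCentre_iff hA'O g
  have hunitL : ∀ g : locAtCentre A'.toSubring O, O.valuation (g : K) = 1 → IsUnit g := by
    intro g hg
    by_contra hng
    have := (not_isUnit_locAtCentre_iff hA'O g).mp hng
    rw [hg] at this; exact lt_irrefl _ this
  -- enumeration of `Y`
  set n : ℕ := Y.card with hndef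
  let yv : Fin n → A.toSubring := fun i => ((Y.equivFin.symm i : Y) : A.toSubring)
  have hyvY : ∀ i, yv i ∈ Y := fun i => (Y.equivFin.symm i).2
  have hyv_of_mem : ∀ y (hy : y ∈ Y), yv (Y.equivFin ⟨y, hy⟩) = y := fun y hy => by
    simp only [yv, Equiv.symm_apply_apply]
  have hprodY : ∀ F : A.toSubring → K, ∏ y ∈ Y, F y = ∏ i : Fin n, F (yv i) := by
    intro F
    rw [← Finset.prod_coe_sort Y]
    exact (Fintype.prod_equiv Y.equivFin.symm (fun i => F (yv i)) (fun y => F y) (fun _ => rfl)).symm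
  -- the generating family `(x, Y / a₀)` of the maximal ideal of `L`
  let xL : Fin t → locAtCentre A'.toSubring O := fun l => ιA (x l)
  let yL : Fin n → locAtCentre A'.toSubring O := fun i => ιA' ⟨((yv i : A.toSubring) : K) / (a₀ : K), hydivA' _ (hyvY i)⟩
  let gen : Fin (t + n) → locAtCentre A'.toSubring O := Fin.append xL yL
  have hgen_left : ∀ l, ((gen (Fin.castAdd n l) : locAtCentre A'.toSubring O) : K) = (x l : K) := fun l => by
    simp only [gen, Fin.append_left]; rfl
  have hgen_right : ∀ i, ((gen (Fin.natAdd t i) : locAtCentre A'.toSubring O) : K) =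
      ((yv i : A.toSubring) : K) / (a₀ : K) := fun i => by
    simp only [gen, Fin.append_right]; rfl
  set J : Ideal (locAtCentre A'.toSubring O) := Ideal.span (Set.range gen) with hJdef
  have hxJ : ∀ l, xL l ∈ J := fun l => Ideal.subset_span ⟨Fin.castAdd n l, by simp only [gen, Fin.append_left]⟩
  have hyJ : ∀ i, yL i ∈ J := fun i => Ideal.subset_span ⟨Fin.natAdd t i, by simp only [gen, Fin.append_right]⟩
  -- `𝔭' A' ⊆ J`
  have hP'J : P'.map ιA' ≤ J := by
    rw [hY', Ideal.map_span, Ideal.span_le]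
    rintro _ ⟨y', hy', rfl⟩
    obtain ⟨y, hy, hyy'⟩ := hY'Y y' hy'
    have : ιA' y' = yL (Y.equivFin ⟨y, hy⟩) := by
      apply Subtype.ext
      rw [hιA'val, hyy']
      change _ = ((yv (Y.equivFin ⟨y, hy⟩) : A.toSubring) : K) / (a₀ : K)
      rw [hyv_of_mem y hy]
    rw [SetLike.mem_coe, this]; exact hyJ _
  have hPJ : ∀ π : A.toSubring, π ∈ P → ιA π ∈ J := by
    intro π hπ
    have h1 : (⟨(π : K), hAA'' π.2⟩ : A'.toSubring) ∈ P' := (hmemP' _).mpr ((hmemP π).mp hπ)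
    exact hP'J (Ideal.mem_map_of_mem ιA' h1)
  -- `J = 𝔪_L`
  have hJmax : J = maximalIdeal (locAtCentre A'.toSubring O) := by
    apply le_antisymm
    · rw [hJdef, Ideal.span_le]
      rintro _ ⟨i, rfl⟩
      rw [SetLike.mem_coe, hmem𝔪]
      induction i using Fin.addCases with
      | left l => rw [hgen_left]; exact hxQ l
      | right j => rw [hgen_right]; exact hydivQ _ (hyvY j)
    · intro f hf
      rw [hmem𝔪] at hf
      obtain ⟨g, hg, s, hs, hs1, hfgs⟩ := (mem_locAtCentre_iff).mp f.2
      have hs0 : s ≠ 0 := ne_zero_of_valuation_eq_one hs1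
      have hgval : O.valuation g < 1 := by
        have : O.valuation (f : K) = O.valuation g := by rw [hfgs, map_div₀, hs1, div_one]
        rw [← this]; exact hf
      -- `g ≡ c₀ (mod 𝔭')` for some `c₀ ∈ A`
      obtain ⟨c₀, hc₀⟩ := hres ⟨g, hg⟩
      have hgc₀ : (⟨g, hg⟩ - ⟨(c₀ : K), hAA'' c₀.2⟩ : A'.toSubring) ∈ P' := by
        rw [← residue_inclusion_eq_zero_iff O₁ A' hA'O₁, map_sub, sub_eq_zero]
        exact hc₀
      have hc₀val : O.valuation (c₀ : K) < 1 := by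
        have h1 : O.valuation ((g : K) - (c₀ : K)) < 1 := (hmemQ' _).mp (hP'Q' hgc₀)
        have : (c₀ : K) = g - (g - (c₀ : K)) := by ring
        rw [this]
        exact lt_of_le_of_lt (Valuation.map_sub _ _ _) (max_lt hgval h1)
      obtain ⟨s', b, hs'1, hb⟩ := hx𝔪 c₀ hc₀val
      have hπ'P : (s' * c₀ - ∑ l, b l * x l : A.toSubring) ∈ P := (hmemP _).mpr hb
      -- `s' · c₀ ∈ J`
      have hc₀J : ιA s' * ιA c₀ ∈ J := by
        have : ιA s' * ιA c₀ = ιA (s' * c₀ - ∑ l, b l * x l) + ∑ l, ιA (b l) * xL l := by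
          simp only [map_sub, map_mul, map_sum, xL]; ring
        rw [this]
        exact J.add_mem (hPJ _ hπ'P) (J.sum_mem fun l _ => J.mul_mem_left _ (hxJ l))
      have hs'unit : IsUnit (ιA s') := hunitL _ (by rw [hιAval]; exact hs'1)
      have hc₀J' : ιA c₀ ∈ J := (Ideal.unit_mul_mem_iff_mem J hs'unit).mp hc₀J
      -- `g ∈ J`
      have hgJ : ιA' ⟨g, hg⟩ ∈ J := by
        have : ιA' ⟨g, hg⟩ = ιA' (⟨g, hg⟩ - ⟨(c₀ : K), hAA'' c₀.2⟩) + ιA c₀ := by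
          rw [map_sub]; change _ = _ - ιA c₀ + ιA c₀; ring
        rw [this]
        exact J.add_mem (hP'J (Ideal.mem_map_of_mem ιA' hgc₀)) hc₀J'
      have hsunit : IsUnit (ιA' ⟨s, hs⟩) := hunitL _ (by rw [hιA'val]; exact hs1)
      have : ιA' ⟨s, hs⟩ * f = ιA' ⟨g, hg⟩ := by
        apply Subtype.ext
        change s * (f : K) = g
        rw [hfgs]; field_simp
      exact (Ideal.unit_mul_mem_iff_mem J hsunit).mp (this ▸ hgJ)
  -- THE COUNT: `dim L ≥ t + #Y`
  have e1 : Localization.AtPrime P' ≃+* locAtCentre A'.toSubring O₁ := (locAtCentreEquiv hA'O₁).toRingEquiv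
  have e2 : Localization.AtPrime P ≃+* locAtCentre A.toSubring O₁ := (locAtCentreEquiv hAO₁).toRingEquiv
  have e3 : Localization.AtPrime Q' ≃+* locAtCentre A'.toSubring O := (locAtCentreEquiv hA'O).toRingEquiv
  have hdimP' : ringKrullDim (Localization.AtPrime P') = ringKrullDim (Localization.AtPrime P) := by
    rw [ringKrullDim_eq_of_ringEquiv e1, ringKrullDim_eq_of_ringEquiv e2, hα]
  have hr : ((n : ℕ) : ℕ∞) ≤ P'.height := by
    have h1 := IsLocalization.AtPrime.ringKrullDim_eq_height P' (Localization.AtPrime P')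
    rw [hdimP'] at h1
    have h2 : ((n : ℕ) : WithBot ℕ∞) ≤ (P'.height : WithBot ℕ∞) := h1 ▸ hYcard
    exact_mod_cast h2
  have hdimquot : ringKrullDim (Localization.AtPrime Q' ⧸ P'.map (algebraMap A'.toSubring (Localization.AtPrime Q'))) =
      ringKrullDim (Localization.AtPrime Q ⧸ P.map (algebraMap A.toSubring (Localization.AtPrime Q))) := by
    obtain ⟨θ, hθ⟩ := exists_centreResidueLift O O₁ hO A hA
    obtain ⟨θ', hθ'⟩ := exists_centreResidueLift O O₁ hO A' hA'O
    have hrange := range_centreResidueLift_eq O O₁ hO A hA θ hθ A' hA'O hAA' θ' hθ' hres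
    obtain ⟨e₁⟩ := nonempty_quotCentre_ringEquiv_range O O₁ hO A hA θ hθ
    obtain ⟨e₂⟩ := nonempty_quotCentre_ringEquiv_range O O₁ hO A' hA'O θ' hθ'
    exact ringKrullDim_eq_of_ringEquiv (e₂.trans ((RingEquiv.subringCongr hrange).trans e₁.symm))
  have ht : ((t : ℕ) : ℕ∞) ≤ (Q'.map (Ideal.Quotient.mk P')).height := by
    have h1 := ringKrullDim_localization_quotient P' Q' hP'Q'
    rw [hdimquot, hdimt] at h1
    have h2 : ((t : ℕ) : WithBot ℕ∞) ≤ ((Q'.map (Ideal.Quotient.mk P')).height : WithBot ℕ∞) := le_of_eq h1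
    exact_mod_cast h2
  have hsum := add_le_height_of_le P' Q' hP'Q' n t hr ht
  have hdimL : ((t + n : ℕ) : WithBot ℕ∞) ≤ ringKrullDim (locAtCentre A'.toSubring O) := by
    rw [← ringKrullDim_eq_of_ringEquiv e3,
      IsLocalization.AtPrime.ringKrullDim_eq_height Q' (Localization.AtPrime Q'), Nat.add_comm]
    exact_mod_cast hsum
  haveI hnoethL : IsNoetherianRing (locAtCentre A'.toSubring O) := isNoetherianRing_of_ringEquiv _ e3
  obtain ⟨hdimeq, hregL⟩ := ringKrullDim_eq_of_span_range_eq_maximalIdeal gen hJmax hdimL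
  -- ASSEMBLY
  refine ⟨A', hA'O, hAA', hA'fg, hα, hregL, t + n, gen, hJmax, hdimeq, ?_⟩
  intro z hzZ hz0
  obtain ⟨s, hs1, hsc⟩ := hcu z hzZ
  obtain ⟨huL, hu1⟩ := hu z hzZ
  -- `π := s (c_z - u_z x^δ) ∈ locAtCentre A O`; write it as `n / e`, `n ∈ 𝔭`, `ν(e) = 0`
  set πK : K := (s : K) * (((c z : A.toSubring) : K) - u z * ∏ l, ((x l : A.toSubring) : K) ^ (δ z l)) with hπKdef
  have hπL : πK ∈ locAtCentre A.toSubring O := by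
    refine Subring.mul_mem _ (le_locAtCentre _ _ s.2) (Subring.sub_mem _ (le_locAtCentre _ _ (c z).2)
      (Subring.mul_mem _ huL (Subring.prod_mem _ fun l _ => Subring.pow_mem _ (le_locAtCentre _ _ (x l).2) _)))
  obtain ⟨πn, hπnA, πe, hπeA, hπe1, hπfrac⟩ := (mem_locAtCentre_iff).mp hπL
  have hπe0 : πe ≠ 0 := ne_zero_of_valuation_eq_one hπe1
  have hπe1' : O₁.valuation πe = 1 := by
    apply le_antisymm ((O₁.valuation_le_one_iff _).mpr (hO (hA hπeA)))
    have hinvO : πe⁻¹ ∈ O := (O.valuation_le_one_iff _).mp (by rw [map_inv₀, hπe1, inv_one])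
    have h2 : O₁.valuation πe⁻¹ ≤ 1 := (O₁.valuation_le_one_iff _).mpr (hO hinvO)
    rw [map_inv₀] at h2
    exact (inv_le_one₀ (by rw [Valuation.pos_iff]; exact hπe0)).mp h2
  set π : A.toSubring := ⟨πn, hπnA⟩ with hπdef
  have hπP : π ∈ P := by
    rw [hmemP]
    have : O₁.valuation πK = O₁.valuation πn := by rw [hπfrac, map_div₀, hπe1', div_one]
    change O₁.valuation πn < 1
    rw [← this]; exact hsc
  obtain ⟨hjA', hj1⟩ := hPdiv π hπP
  have hjQ : O.valuation ((π : K) / (a₀ : K)) < 1 := hvalQ'ofP' _ hjA' hj1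
  set xpow : A.toSubring := ∏ l, x l ^ (m l - δ z l) with hxpowdef
  have hs0 : (s : K) ≠ 0 := ne_zero_of_valuation_eq_one hs1
  have hxδ0 : (∏ l, ((x l : A.toSubring) : K) ^ (δ z l)) ≠ 0 :=
    Finset.prod_ne_zero_iff.mpr fun l _ => pow_ne_zero _ (ne_zero_of_valuation_eq_one (hxP l))
  have ha₀split : (a₀ : K) = (∏ l, ((x l : A.toSubring) : K) ^ (δ z l)) * (xpow : K) := by
    rw [ha₀def, hxpowdef]; push_cast
    rw [← Finset.prod_mul_distrib]
    refine Finset.prod_congr rfl fun l _ => ?_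
    rw [← pow_add, Nat.add_sub_cancel' (hδm z hzZ l)]
  -- the unit `v = c_z / x^{δ_z} = u_z + x^{m-δ_z} · (π / a₀) / (s e)`
  have hse1 : O.valuation ((s : K) * πe) = 1 := by rw [map_mul, hs1, hπe1, one_mul]
  have hwmem : ((xpow : K) * ((π : K) / (a₀ : K))) / ((s : K) * πe) ∈ locAtCentre A'.toSubring O :=
    (mem_locAtCentre_iff).mpr ⟨_, A'.mul_mem (hAA' xpow.2) hjA', (s : K) * πe, A'.mul_mem (hAA' s.2) (hAA' hπeA), hse1, rfl⟩
  have hwval : O.valuation (((xpow : K) * ((π : K) / (a₀ : K))) / ((s : K) * πe)) < 1 := by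
    rw [map_div₀, hse1, div_one, map_mul]
    calc O.valuation (xpow : K) * O.valuation ((π : K) / (a₀ : K))
        ≤ 1 * O.valuation ((π : K) / (a₀ : K)) := by gcongr; exact hvalA'le _ (hAA' xpow.2)
      _ = _ := one_mul _
      _ < 1 := hjQ
  have huL' : u z ∈ locAtCentre A'.toSubring O := locAtCentre_mono O hAA'' huL
  let v : locAtCentre A'.toSubring O := ⟨u z, huL'⟩ + ⟨_, hwmem⟩
  have hvval : O.valuation (v : K) = 1 := by
    change O.valuation (u z + ((xpow : K) * ((π : K) / (a₀ : K))) / ((s : K) * πe)) = 1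
    rw [Valuation.map_add_eq_of_lt_left _ (by rw [hu1]; exact hwval)]
    exact hu1
  have hvK : (v : K) * ∏ l, ((x l : A.toSubring) : K) ^ (δ z l) = ((c z : A.toSubring) : K) := by
    change (u z + ((xpow : K) * ((π : K) / (a₀ : K))) / ((s : K) * πe)) * _ = _
    have hxpow0 : (xpow : K) ≠ 0 := by
      intro h; apply ha₀0; rw [ha₀split, h, mul_zero]
    have hπn : (π : K) = πe * πK := by
      change πn = πe * πK
      rw [hπfrac]; field_simp
    rw [ha₀split, hπn, hπKdef]
    field_simp
    ring
  -- exponents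
  let N : ℕ := ∑ j : Fin n, γ z (yv j)
  let μ : Fin (t + n) → ℕ := Fin.append (fun l => δ z l + N * m l) (fun j => γ z (yv j))
  refine ⟨v, μ, hunitL v hvval, ?_⟩
  -- the monomial identity, in `K`
  have hgenprod : ∏ i, ((gen i : locAtCentre A'.toSubring O) : K) ^ (μ i) =
      (∏ l, ((x l : A.toSubring) : K) ^ (δ z l + N * m l)) *
        ∏ j, (((yv j : A.toSubring) : K) / (a₀ : K)) ^ (γ z (yv j)) := by
    rw [Fin.prod_univ_add]
    congr 1
    · exact Finset.prod_congr rfl fun l _ => by rw [hgen_left]; simp only [μ, Fin.append_left]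
    · exact Finset.prod_congr rfl fun j _ => by rw [hgen_right]; simp only [μ, Fin.append_right]
  have hxsplit : (∏ l, ((x l : A.toSubring) : K) ^ (δ z l + N * m l)) =
      (∏ l, ((x l : A.toSubring) : K) ^ (δ z l)) * (a₀ : K) ^ N := by
    rw [ha₀def]; push_cast
    rw [← Finset.prod_pow, ← Finset.prod_mul_distrib]
    refine Finset.prod_congr rfl fun l _ => ?_
    rw [pow_add, ← pow_mul, Nat.mul_comm]
  have hysplit : ∏ j, (((yv j : A.toSubring) : K) / (a₀ : K)) ^ (γ z (yv j)) =
      (∏ j, ((yv j : A.toSubring) : K) ^ (γ z (yv j))) / (a₀ : K) ^ N := by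
    simp only [div_pow]
    rw [Finset.prod_div_distrib, Finset.prod_pow_eq_pow_sum]
  have ha₀N : (a₀ : K) ^ N ≠ 0 := pow_ne_zero _ ha₀0
  rw [hgenprod, hxsplit, hysplit]
  conv_lhs => rw [hz z hzZ, hprodY, ← hvK]
  field_simp

end Summit.ResolutionOfSingularities.ResolutionOfSingularities.Theorems.RadicialJung.CleanModels

end
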